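import Summits.QuantumFields.YangMills.Theses.WeakCouplingMasslessPhase
import Literature.MathematicalPhysics.QuantumLattice.CentreSymmetryConfinementProofs
import Literature.MathematicalPhysics.QuantumLattice.LatticeGaugeDLRGibbsProofs
import Literature.MathematicalPhysics.QuantumLattice.WilsonLoopsProofs
import Literature.MathematicalPhysics.QuantumLattice.GaugeGroupsProofs
import HarnessLib

/-!
# Stub B of the birth line of crux `DeconfinedIsMassless` (stmt-QuantumFields-19521):
# unbroken slab centre symmetry ⇒ no perimeter law in any torus limit state

Helper file for item `stmt-QuantumFields-19521` (crux `DeconfinedIsMassless`, rank 3, of the REFUTATION route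
`route-QuantumFields-WeakCouplingMasslessPhase`; `--supports`, closes nothing by itself). It proves, sorry-free, the
registered stub `stub_not_perimeter_of_centreUnbroken` (stub B, «Chatterjee 2021 Thm 2.2 in torus-primary form») of the
birth skeleton `Summits/QuantumFields/YangMills/Cruxes/DeconfinedIsMassless/Lines/birth.lean` (skeleton sha
`ebd9e11d7074`), as `Summit.QuantumFields.YangMills.Theorems.DeconfinedIsMassless.stub_not_perimeter_of_centreUnbroken`
— statement copied byte-for-byte from the skeleton, so that the skeleton's `sorry` is replaced by
`:= Summit.QuantumFields.YangMills.Theorems.DeconfinedIsMassless.stub_not_perimeter_of_centreUnbroken`.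

Statement (stub B): for every `N ≥ 2`, every faithful continuous unitary lattice representation `r` of `SU(N)` and every
`β > 0`: IF for some width `W ≥ 1` every probability measure on `LGConfig 4 SU(N)` that equals a boundary condition `δ`
a.e. off the interior edges of the slab `{0 ≤ x₀ ≤ W}` and is DLR for the Wilson kernels `ymSpecification r.ρ β Λ` of
the finite sets `Λ` of interior edges is invariant under every centre transform (Chatterjee 2021 Def. 2.1, inlined by
the planner over tree vocabulary), THEN no infinite-volume torus limit state `μ ∈ infiniteVolumeLimitPoints r.ρ β` has
a perimeter law (`HasPerimeterLaw`) for the normalised fundamental character `g ↦ (1/N) Re tr g`.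

## Proof (glue onto the tree; no new mathematics)

* The inlined hypothesis IS `Literature.MathematicalPhysics.QuantumLattice.CentreUnbroken 4 r.ρ β` (Chatterjee 2021
  Def. 2.1, `CentreSymmetry.lean`): a member of `slabGibbsMeasures r.ρ β W δ` is a probability measure, concentrated
  on `{U = δ off the interior edges}` (`IsSlabInteriorEdge W`, whose clause `x₀ + 1 ≤ W` is the planner's `x₀ < W`),
  and DLR for `slabSpecification r.ρ β W Λ = ymSpecification r.ρ β (Λ ∩ interior)`, which for `Λ ⊆ interior` is the
  planner's kernel; the planner's transform is `centreTransform z` on the nose (`centreUnbroken_of_inlined`).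
* Torus limit states are DLR states: `mem_ymGibbsMeasures_of_mem_infiniteVolumeLimitPoints_holds`
  (`LatticeGaugeDLRGibbsProofs.lean`, Georgii Thm. 4.17 for the Wilson specification).
* **Chatterjee 2021, Theorem 2.2** is PROVED in the tree: `chatterjee2021_confinement_of_centreUnbroken_holds`
  (`CentreSymmetryConfinementProofs.lean`). We apply it at `d = 4`, `G = SU(N)` (connected:
  `connectedSpace_specialUnitaryGroup`; compact, second countable, Borel: `GaugeGroups.lean`), `ρ = r.ρ`, and
  `π =` the fundamental representation, which is continuous, unitary, IRREDUCIBLE for `N ≥ 2`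
  (`isIrrep_fundamentalRep`, proved here: an invariant subspace containing `v ≠ 0` contains a coordinate vector by two
  diagonal `SU(N)` moves `diag(…,−1,…,−1,…)`, `diag(…,i,…,−i,…)`, hence all of them by the signed transpositions) and
  acts non-trivially on the centre (`ω·1 ∈ Z(SU(N))`, `ω = e^{2πi/N} ≠ 1`). This gives `V → ∞` with
  `‖∫ tr hol_{R×T} dμ‖ ≤ e^{−V(R) T}` for `1 ≤ R ≤ T` in every DLR state.
* Perimeter law `e^{−2c(R+T)} ≤ W_μ(R,T) = (1/N) Re ∫ tr hol ≤ e^{−V(R)T}`: pick `R` with `V(R) ≥ 2c + 1`, then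
  `T ≤ 2cR` for all `T ≥ R` — false at `T = max R (⌈2cR⌉₊ + 1)`.

Sources: S. Chatterjee, *A probabilistic mechanism for quark confinement*, CMP 385 (2021), arXiv:2006.16229, Def. 2.1,
Thm. 2.2 (held text `paper:arxiv-2006.16229`, p0006, p0008–p0009). No named fact is introduced; no `sorry`;
axioms ⊆ {propext, Classical.choice, Quot.sound}.
-/

set_option autoImplicit false

noncomputable section

namespace Summit.QuantumFields.YangMills.Theorems.DeconfinedIsMassless

open MeasureTheory Filter Topology
open Literature.Probability.LatticeModels
open Literature.MathematicalPhysics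
open Literature.MathematicalPhysics.QuantumLattice

/-! ### The fundamental representation of `SU(N)`, `N ≥ 2`, is irreducible -/

section Irrep

open Literature.Analysis.Convex

variable {N : ℕ}

/-- The diagonal circle `D_{kl}(w) = diag(…, w (at k), …, w⁻¹ (at l), …) ∈ SU(N)` acts on `ℂ^N` coordinatewise:
`(D v)_x = pairFun k l w x · v_x`. [folklore] -/
private theorem dPairHom_mulVec (k l : Fin N) (w : Circle) (v : Fin N → ℂ) (x : Fin N) :
    ((dPairHom k l w : Matrix.specialUnitaryGroup (Fin N) ℂ) : Matrix (Fin N) (Fin N) ℂ).mulVec v x =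
      pairFun k l (w : ℂ) x * v x := by
  rw [coe_dPairHom, Matrix.mulVec_diagonal]

/-- The signed transposition `sSwap j k ∈ SU(N)` (`j ≠ k`) maps the coordinate vector `e_k` to `−e_j`. [folklore] -/
private theorem sSwap_mulVec_single {j k : Fin N} (hjk : j ≠ k) :
    ((sSwap j k : Matrix.specialUnitaryGroup (Fin N) ℂ) : Matrix (Fin N) (Fin N) ℂ).mulVec (Pi.single k 1) =
      -(Pi.single j (1 : ℂ)) := by
  rw [coe_sSwap, sSwapMatrix, if_neg hjk, ← Matrix.mulVec_mulVec, Matrix.swap_mulVec]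
  have hcomp : (Pi.single k (1 : ℂ) : Fin N → ℂ) ∘ Equiv.swap j k = Pi.single j 1 := by
    funext x
    simp only [Function.comp_apply]
    by_cases hxj : x = j
    · subst hxj; simp
    · by_cases hxk : x = k
      · subst hxk
        rw [Equiv.swap_apply_right, Pi.single_eq_of_ne hjk, Pi.single_eq_of_ne (Ne.symm hjk)]
      · rw [Equiv.swap_apply_of_ne_of_ne hxj hxk, Pi.single_eq_of_ne hxk, Pi.single_eq_of_ne hxj]
  rw [hcomp]
  funext x
  rw [Matrix.mulVec_diagonal, Pi.neg_apply]
  by_cases hxj : x = j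
  · subst hxj; simp
  · simp [Pi.single_eq_of_ne hxj]

/-- **The defining representation of `SU(N)` on `ℂ^N` is irreducible** (`N ≥ 2`): a non-zero `SU(N)`-invariant
subspace `W ∋ v`, `v_k ≠ 0`, contains `v − D_{kl}(−1)v = 2(v_k e_k + v_l e_l)`, then
`u − i·D_{kl}(i)u = 4 v_k e_k`, hence `e_k`, hence every `e_j = −sSwap(j,k) e_k`, hence everything
(Bröcker–tom Dieck II §1 / §5: the standard representation of `SU(n)` is irreducible). [folklore] -/
theorem isIrrep_fundamentalRep (hN : 2 ≤ N) : SymmetryAdapted.IsIrrep (fundamentalRep (Fin N)) := by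
  classical
  haveI : Nontrivial (Fin N) := Fin.nontrivial_iff_two_le.2 hN
  rw [SymmetryAdapted.isIrrep_iff]
  refine ⟨inferInstance, fun W hW => ?_⟩
  by_cases hbot : W = ⊥
  · exact Or.inl hbot
  right
  obtain ⟨v, hvW, hv0⟩ := (Submodule.ne_bot_iff W).1 hbot
  obtain ⟨k, hk⟩ : ∃ k, v k ≠ 0 := Function.ne_iff.1 hv0
  obtain ⟨l, hlk⟩ := exists_ne k
  have hW' : ∀ (g : Matrix.specialUnitaryGroup (Fin N) ℂ) (u : Fin N → ℂ), u ∈ W →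
      (g : Matrix (Fin N) (Fin N) ℂ).mulVec u ∈ W := fun g u hu => by
    simpa only [fundamentalRep_apply] using hW g u hu
  -- Step A: `e_k ∈ W`
  set m1 : Circle := circleOfNormEqOne (-1) (by simp) with hm1
  set cI : Circle := circleOfNormEqOne Complex.I (by simp) with hcI
  set u : Fin N → ℂ :=
    v - ((dPairHom k l m1 : Matrix.specialUnitaryGroup (Fin N) ℂ) : Matrix (Fin N) (Fin N) ℂ).mulVec v with hu
  have huW : u ∈ W := W.sub_mem hvW (hW' _ v hvW)
  set t : Fin N → ℂ :=
    u - Complex.I • ((dPairHom k l cI : Matrix.specialUnitaryGroup (Fin N) ℂ) : Matrix (Fin N) (Fin N) ℂ).mulVec u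
    with ht
  have htW : t ∈ W := W.sub_mem huW (W.smul_mem _ (hW' _ u huW))
  have ht_eq : t = (4 * v k) • (Pi.single k (1 : ℂ) : Fin N → ℂ) := by
    funext x
    simp only [ht, hu, Pi.sub_apply, Pi.smul_apply, smul_eq_mul, dPairHom_mulVec, hm1, hcI,
      coe_circleOfNormEqOne, pairFun, Pi.mul_apply, Pi.mulSingle_apply]
    by_cases hxk : x = k
    · subst hxk
      simp only [if_true, if_neg (Ne.symm hlk), Pi.single_eq_same, mul_one]
      have hI : Complex.I * Complex.I = -1 := Complex.I_mul_I
      linear_combination (-(v x + v x)) * hI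
    · by_cases hxl : x = l
      · subst hxl
        simp only [if_neg hxk, if_true, Pi.single_eq_of_ne hxk, mul_zero, one_mul, inv_neg, inv_one,
          Complex.inv_I]
        have hI : Complex.I * Complex.I = -1 := Complex.I_mul_I
        linear_combination (v x + v x) * hI
      · simp [if_neg hxk, if_neg hxl, Pi.single_eq_of_ne hxk]
  have hek : (Pi.single k (1 : ℂ) : Fin N → ℂ) ∈ W := by
    have h4 : (4 * v k : ℂ) ≠ 0 := mul_ne_zero (by norm_num) hk
    have : (4 * v k)⁻¹ • t ∈ W := W.smul_mem _ htW
    rwa [ht_eq, smul_smul, inv_mul_cancel₀ h4, one_smul] at this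
  -- Step B: every `e_j ∈ W`
  have hej : ∀ j : Fin N, (Pi.single j (1 : ℂ) : Fin N → ℂ) ∈ W := by
    intro j
    by_cases hjk : j = k
    · subst hjk; exact hek
    · have h := hW' (sSwap j k) _ hek
      rw [sSwap_mulVec_single hjk] at h
      simpa using W.neg_mem h
  -- conclusion
  rw [eq_top_iff]
  rintro x -
  rw [pi_eq_sum_univ' x]
  exact W.sum_mem fun j _ => W.smul_mem _ (hej j)

/-- A non-trivial central element of `SU(N)`, `N ≥ 2`, on which the fundamental representation is the scalar
`ω = e^{2πi/N} ≠ 1`: `ω·1 ∈ Z(SU(N))` and `π(ω·1) ≠ 1` («`π` acts nontrivially on the center», Chatterjee 2021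
§2.3). [folklore] -/
theorem exists_center_fundamentalRep_ne_one (hN : 2 ≤ N) :
    ∃ g₀ ∈ Subgroup.center (Matrix.specialUnitaryGroup (Fin N) ℂ), fundamentalRep (Fin N) g₀ ≠ 1 := by
  classical
  have hN0 : N ≠ 0 := by omega
  set ω : ℂ := Complex.exp (2 * Real.pi * Complex.I / N) with hω
  have hprim : IsPrimitiveRoot ω N := Complex.isPrimitiveRoot_exp N hN0
  have hω1 : ‖ω‖ = 1 := hprim.norm'_eq_one hN0
  have hωN : ω ^ N = 1 := hprim.pow_eq_one
  have hωne : ω ≠ 1 := hprim.ne_one (by omega)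
  have hmem : Matrix.diagonal (fun _ : Fin N => ω) ∈ Matrix.specialUnitaryGroup (Fin N) ℂ := by
    rw [diagonal_mem_specialUnitaryGroup_iff]
    exact ⟨fun _ => hω1, by simp [hωN]⟩
  refine ⟨⟨Matrix.diagonal fun _ => ω, hmem⟩, ?_, ?_⟩
  · rw [Subgroup.mem_center_iff]
    intro g
    apply Subtype.ext
    change (g : Matrix (Fin N) (Fin N) ℂ) * Matrix.diagonal (fun _ => ω) =
      Matrix.diagonal (fun _ => ω) * (g : Matrix (Fin N) (Fin N) ℂ)
    rw [← Matrix.smul_one_eq_diagonal, mul_smul_comm, smul_mul_assoc, mul_one, one_mul]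
  · intro h
    apply hωne
    have h00 := congrFun (congrFun h ⟨0, by omega⟩) ⟨0, by omega⟩
    simpa [fundamentalRep_apply] using h00

end Irrep

/-! ### The inlined hypothesis is `CentreUnbroken` (Chatterjee 2021 Def. 2.1) -/

section Hypothesis

variable {N : ℕ}

/-- The planner's inlined «slab centre symmetry unbroken at width `W` under every boundary condition» implies the
tree's `CentreUnbroken 4 ρ β` (Chatterjee 2021 Def. 2.1, `CentreSymmetry.lean`): members of
`slabGibbsMeasures ρ β W δ` are probability measures concentrated on `{U = δ off the interior}` and DLR for the
interior Wilson kernels, and the planner's transform is `centreTransform`. [cite: Chatterjee2021, Def. 2.1] -/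
theorem centreUnbroken_of_inlined {M : ℕ} (ρ : Matrix.specialUnitaryGroup (Fin N) ℂ →* Matrix (Fin M) (Fin M) ℂ)
    (β : ℝ)
    (h : ∃ W : ℕ, 1 ≤ W ∧ ∀ (δ : QuantumLattice.LGConfig 4 (Matrix.specialUnitaryGroup (Fin N) ℂ)) (μ : Measure (QuantumLattice.LGConfig 4 (Matrix.specialUnitaryGroup (Fin N) ℂ))), IsProbabilityMeasure μ → (∀ᵐ U ∂μ, ∀ e : QuantumLattice.ZdEdge 4, ¬ ((e.2 = 0 ∧ 0 ≤ e.1 0 ∧ e.1 0 < (W : ℤ)) ∨ (e.2 ≠ 0 ∧ 0 < e.1 0 ∧ e.1 0 < (W : ℤ))) → U e = δ e) → (∀ Λ : Finset (QuantumLattice.ZdEdge 4), (∀ e ∈ Λ, (e.2 = 0 ∧ 0 ≤ e.1 0 ∧ e.1 0 < (W : ℤ)) ∨ (e.2 ≠ 0 ∧ 0 < e.1 0 ∧ e.1 0 < (W : ℤ))) → ∀ E : Set (QuantumLattice.LGConfig 4 (Matrix.specialUnitaryGroup (Fin N) ℂ)), MeasurableSet E → ∫⁻ η, QuantumLattice.ymSpecification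 (d := 4) ρ β Λ η E ∂μ = μ E) → ∀ z : Matrix.specialUnitaryGroup (Fin N) ℂ, z ∈ Subgroup.center (Matrix.specialUnitaryGroup (Fin N) ℂ) → μ.map (fun (U : QuantumLattice.LGConfig 4 (Matrix.specialUnitaryGroup (Fin N) ℂ)) (e : QuantumLattice.ZdEdge 4) => if e.2 = 0 ∧ e.1 0 = 0 then z * U e else U e) = μ) :
    CentreUnbroken 4 ρ β := by
  obtain ⟨W, hW1, hW⟩ := h
  refine ⟨W, hW1, fun δ g₀ hg₀ μ hμ => ?_⟩
  obtain ⟨⟨hprob, hdlr⟩, hbc⟩ := hμ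
  -- the planner's interior predicate is `IsSlabInteriorEdge W` (`x₀ < W ↔ x₀ + 1 ≤ W` on `ℤ`)
  have hiff : ∀ e : ZdEdge 4, ((e.2 = 0 ∧ 0 ≤ e.1 0 ∧ e.1 0 < (W : ℤ)) ∨ (e.2 ≠ 0 ∧ 0 < e.1 0 ∧ e.1 0 < (W : ℤ))) ↔
      IsSlabInteriorEdge W e := fun e => by
    simp only [IsSlabInteriorEdge, Int.lt_iff_add_one_le]
  have hbc' : ∀ᵐ U ∂μ, ∀ e : ZdEdge 4,
      ¬ ((e.2 = 0 ∧ 0 ≤ e.1 0 ∧ e.1 0 < (W : ℤ)) ∨ (e.2 ≠ 0 ∧ 0 < e.1 0 ∧ e.1 0 < (W : ℤ))) → U e = δ e := by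
    filter_upwards [hbc] with U hU e he
    exact hU e (fun h' => he ((hiff e).2 h'))
  have hdlr' : ∀ Λ : Finset (ZdEdge 4),
      (∀ e ∈ Λ, (e.2 = 0 ∧ 0 ≤ e.1 0 ∧ e.1 0 < (W : ℤ)) ∨ (e.2 ≠ 0 ∧ 0 < e.1 0 ∧ e.1 0 < (W : ℤ))) →
      ∀ E : Set (LGConfig 4 (Matrix.specialUnitaryGroup (Fin N) ℂ)), MeasurableSet E →
        ∫⁻ η, ymSpecification (d := 4) ρ β Λ η E ∂μ = μ E := by
    intro Λ hΛ E hE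
    have hΛ' : ∀ e ∈ Λ, IsSlabInteriorEdge W e := fun e he => (hiff e).1 (hΛ e he)
    have h1 := hdlr Λ E hE
    simp only [slabSpecification, Finset.filter_true_of_mem hΛ'] at h1
    exact h1
  exact hW δ μ hprob hbc' hdlr' g₀ hg₀

end Hypothesis

/-! ### Bookkeeping: the real loop expectation vs the complex trace integral -/

section Loop

variable {N : ℕ}

/-- The complex loop variable `U ↦ tr hol_{R×T}(U)` (fundamental representation) is integrable in every
probability measure on the compact metrisable configuration space (continuous, entries of unitaries `≤ 1`).
[folklore] -/
private theorem integrable_trace_hol (μ : Measure (LGConfig 4 (Matrix.specialUnitaryGroup (Fin N) ℂ)))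
    [IsProbabilityMeasure μ] (R T : ℕ) :
    Integrable (fun U : LGConfig 4 (Matrix.specialUnitaryGroup (Fin N) ℂ) =>
      ((fundamentalRep (Fin N)) (walkHolonomy U (rectWalk 0 0 1 R T))).trace) μ := by
  have hc : Continuous fun U : LGConfig 4 (Matrix.specialUnitaryGroup (Fin N) ℂ) =>
      ((fundamentalRep (Fin N)) (walkHolonomy U (rectWalk 0 0 1 R T))).trace :=
    ((continuous_fundamentalRep (Fin N)).comp (continuous_walkHolonomy _)).matrix_trace
  refine Integrable.of_bound hc.aestronglyMeasurable ((N : ℝ) * 1) (ae_of_all _ fun U => ?_)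
  -- `|tr M| ≤ N` for unitary `M`
  have hM := fundamentalRep_mem_unitaryGroup (walkHolonomy U (rectWalk (0 : Site 4) 0 1 R T))
  simp only [Matrix.trace, Matrix.diag]
  calc ‖∑ i, (fundamentalRep (Fin N)) (walkHolonomy U (rectWalk (0 : Site 4) 0 1 R T)) i i‖
      ≤ ∑ i, ‖(fundamentalRep (Fin N)) (walkHolonomy U (rectWalk (0 : Site 4) 0 1 R T)) i i‖ := norm_sum_le _ _
    _ ≤ ∑ _i : Fin N, (1 : ℝ) := Finset.sum_le_sum fun i _ => entry_norm_bound_of_unitary hM i i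
    _ = (N : ℝ) * 1 := by simp

/-- `W_μ(R,T) = (1/N) Re ∫ tr hol_{R×T} dμ` for the normalised fundamental character. [folklore] -/
private theorem rectExpectation_eq_re (μ : Measure (LGConfig 4 (Matrix.specialUnitaryGroup (Fin N) ℂ)))
    [IsProbabilityMeasure μ] (R T : ℕ) :
    rectExpectation μ (fun g => normalisedCharacter N (fundamentalRep (Fin N) g)) 0 1 R T =
      (N : ℝ)⁻¹ * (∫ U, ((fundamentalRep (Fin N)) (walkHolonomy U (rectWalk 0 0 1 R T))).trace ∂μ).re := by
  simp only [rectExpectation, loopExpectation, wilsonLoopObs, normalisedCharacter]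
  rw [integral_const_mul]
  have h := integral_re (integrable_trace_hol μ R T)
  simp only [RCLike.re_to_complex] at h
  rw [h]

end Loop

/-! ### Stub B -/

/-- **Stub B of the birth line of `DeconfinedIsMassless`** — unbroken slab centre symmetry ⇒ no perimeter law in
any torus limit state (Chatterjee 2021 Thm. 2.2, torus-primary form; the registered statement of
`stub_not_perimeter_of_centreUnbroken`, verbatim). For `N ≥ 2`, a faithful continuous unitary `r` of `SU(N)` and
`β > 0`: if for some width `W ≥ 1` every slab Gibbs state with every boundary condition is invariant under every
centre transform, then no `μ ∈ infiniteVolumeLimitPoints (d := 4) r.ρ β` has a perimeter law for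
`g ↦ (1/N) Re tr g`. Proof: the hypothesis is `CentreUnbroken 4 r.ρ β` (`centreUnbroken_of_inlined`); `μ` is a DLR
state (`mem_ymGibbsMeasures_of_mem_infiniteVolumeLimitPoints_holds`); Chatterjee's Theorem 2.2
(`chatterjee2021_confinement_of_centreUnbroken_holds`, applied to the irreducible fundamental representation,
`isIrrep_fundamentalRep`, which sees the centre, `exists_center_fundamentalRep_ne_one`) bounds
`W_μ(R,T) ≤ (1/N)‖∫ tr hol‖ ≤ e^{−V(R)T}` with `V(R) → ∞`, incompatible with `e^{−2c(R+T)} ≤ W_μ(R,T)` at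
`V(R) ≥ 2c + 1`, `T > 2cR`. [cite: Chatterjee2021, Thm. 2.2] -/
theorem stub_not_perimeter_of_centreUnbroken :
    ∀ (N : ℕ), 2 ≤ N → ∀ r : QuantumFieldTheory.LatticeRep (Matrix.specialUnitaryGroup (Fin N) ℂ), ∀ β : ℝ, 0 < β → (∃ W : ℕ, 1 ≤ W ∧ ∀ (δ : QuantumLattice.LGConfig 4 (Matrix.specialUnitaryGroup (Fin N) ℂ)) (μ : Measure (QuantumLattice.LGConfig 4 (Matrix.specialUnitaryGroup (Fin N) ℂ))), IsProbabilityMeasure μ → (∀ᵐ U ∂μ, ∀ e : QuantumLattice.ZdEdge 4, ¬ ((e.2 = 0 ∧ 0 ≤ e.1 0 ∧ e.1 0 < (W : ℤ)) ∨ (e.2 ≠ 0 ∧ 0 < e.1 0 ∧ e.1 0 < (W : ℤ))) → U e = δ e) → (∀ Λ : Finset (QuantumLattice.ZdEdge 4), (∀ e ∈ Λ, (e.2 = 0 ∧ 0 ≤ e.1 0 ∧ e.1 0 < (W : ℤ)) ∨ (e.2 ≠ 0 ∧ 0 < e.1 0 ∧ e.1 0 < (W : ℤ))) → ∀ E : Set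 (QuantumLattice.LGConfig 4 (Matrix.specialUnitaryGroup (Fin N) ℂ)), MeasurableSet E → ∫⁻ η, QuantumLattice.ymSpecification (d := 4) r.ρ β Λ η E ∂μ = μ E) → ∀ z : Matrix.specialUnitaryGroup (Fin N) ℂ, z ∈ Subgroup.center (Matrix.specialUnitaryGroup (Fin N) ℂ) → μ.map (fun (U : QuantumLattice.LGConfig 4 (Matrix.specialUnitaryGroup (Fin N) ℂ)) (e : QuantumLattice.ZdEdge 4) => if e.2 = 0 ∧ e.1 0 = 0 then z * U e else U e) = μ) → ∀ μ ∈ QuantumLattice.infiniteVolumeLimitPoints (d := 4) r.ρ β, ¬ QuantumLattice.HasPerimeterLaw μ (fun g => QuantumLattice.normalisedCharacter N (QuantumLattice.fundamentalRep (Fin N) g)) := by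
  intro N hN r β _hβ hCU μ hμ hper
  classical
  haveI : Nonempty (Fin N) := ⟨⟨0, by omega⟩⟩
  haveI : ConnectedSpace (Matrix.specialUnitaryGroup (Fin N) ℂ) := connectedSpace_specialUnitaryGroup
  -- (1) the hypothesis is Chatterjee's Definition 2.1
  have hcu : CentreUnbroken 4 r.ρ β := centreUnbroken_of_inlined r.ρ β hCU
  -- (2) torus limit states are DLR states
  have hG : μ ∈ ymGibbsMeasures r.ρ β :=
    mem_ymGibbsMeasures_of_mem_infiniteVolumeLimitPoints_holds (d := 4) r.ρ r.continuous hμ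
  haveI : IsProbabilityMeasure μ := hG.1
  -- (3) Chatterjee's Theorem 2.2 for the fundamental representation
  obtain ⟨V, hV, hbound⟩ :=
    chatterjee2021_confinement_of_centreUnbroken_holds 4 (by norm_num)
      (Matrix.specialUnitaryGroup (Fin N) ℂ) r.N r.ρ r.continuous r.injective r.mem_unitary β hcu
      N (fundamentalRep (Fin N)) (continuous_fundamentalRep (Fin N)) fundamentalRep_mem_unitaryGroup
      (isIrrep_fundamentalRep hN) (exists_center_fundamentalRep_ne_one hN)
  -- (4) the perimeter law contradicts `V(R) → ∞`
  obtain ⟨c, hc⟩ := hper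
  obtain ⟨R, hVR, hR1⟩ := ((hV.eventually_ge_atTop (2 * c + 1)).and (eventually_ge_atTop 1)).exists
  set T : ℕ := max R (⌈2 * c * R⌉₊ + 1) with hT
  have hRT : R ≤ T := le_max_left _ _
  have hT1 : 1 ≤ T := hR1.trans hRT
  have hTgt : 2 * c * R < (T : ℝ) := by
    have h1 : (2 * c * R : ℝ) ≤ ⌈2 * c * R⌉₊ := Nat.le_ceil _
    have h2 : ((⌈2 * c * (R : ℝ)⌉₊ + 1 : ℕ) : ℝ) ≤ T := by exact_mod_cast le_max_right R (⌈2 * c * R⌉₊ + 1)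
    push_cast at h2
    linarith
  have hNpos : (0 : ℝ) < N := by exact_mod_cast (show 0 < N by omega)
  have hNinv : (N : ℝ)⁻¹ ≤ 1 := inv_le_one_of_one_le₀ (by exact_mod_cast (show 1 ≤ N by omega))
  -- upper bound from Theorem 2.2
  have hup : rectExpectation μ (fun g => normalisedCharacter N (fundamentalRep (Fin N) g)) 0 1 R T ≤
      Real.exp (-(V R * T)) := by
    rw [rectExpectation_eq_re μ R T]
    have h01 : (0 : Fin 4) ≠ 1 := Fin.zero_ne_one'
    have h1 := hbound μ hG 0 0 1 h01 R T hR1 hRT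
    calc (N : ℝ)⁻¹ * (∫ U, ((fundamentalRep (Fin N)) (walkHolonomy U (rectWalk 0 0 1 R T))).trace ∂μ).re
        ≤ (N : ℝ)⁻¹ * ‖∫ U, ((fundamentalRep (Fin N)) (walkHolonomy U (rectWalk 0 0 1 R T))).trace ∂μ‖ :=
          mul_le_mul_of_nonneg_left (Complex.re_le_norm _) (inv_nonneg.2 hNpos.le)
      _ ≤ 1 * Real.exp (-(V R * T)) :=
          mul_le_mul hNinv h1 (norm_nonneg _) zero_le_one
      _ = Real.exp (-(V R * T)) := one_mul _
  -- lower bound from the perimeter law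
  have hlow := hc R T hR1 hT1
  have hcmp : Real.exp (-c * (2 * (R + T))) ≤ Real.exp (-(V R * T)) := hlow.trans hup
  rw [Real.exp_le_exp] at hcmp
  -- `(V R − 2c) T ≤ 2 c R` with `V R − 2c ≥ 1` and `T > 2cR`: contradiction
  have hTpos : (0 : ℝ) ≤ T := Nat.cast_nonneg T
  have h3 : (T : ℝ) ≤ (V R - 2 * c) * T := by nlinarith
  have h4 : (V R - 2 * c) * T ≤ 2 * c * R := by nlinarith
  linarith

end Summit.QuantumFields.YangMills.Theorems.DeconfinedIsMassless

end
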